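import Summits.CriticalPhenomena.PercolationContinuityZ3.Theorems.PercNearOneGluingAdditiveGluingSandwichPrelim
import Summits.CriticalPhenomena.PercolationContinuityZ3.Theorems.PercNearOneGluingAdditiveGluingBystanderCluster
import HarnessLib

/-!
# Sandwich BHK inequality — base case (crux `PercNearOneGluing.AdditiveGluing`,
stmt-CriticalPhenomena-4576; siege k18, file 2/5, registered stub `stub_sandwichBase_k18`)

The base inequality of the sandwich induction (true for all `S, T`):
`P(a↔b, E_S, a↮S) · P(a↮T) ≤ P(a↔b) · P(E_{S∪T}, a↮S∪T)` for the sandwich event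
`E_X = {o ↔ X} ∪ ({o ↮ X} ∩ {C(o) ∈ R})` (`R` a family of vertex sets avoiding `a`).
Proof: decompose `E_S ∩ {a ↮ S}` along the value `Y ∋ o` of the set reachable from `S` and the
values `W ∈ R` of the cluster of `o`; each piece is determined by the edges meeting `Y` (resp.
`W`) and forces the moat of `Y` to be closed, so the moat lemma (file 1/5) applies, and the
pieces `∩ {a ↮ T}` are disjoint sub-events of `E_{S∪T} ∩ {a ↮ S ∪ T}`.
(Independent parallel developments of the same idea by sibling seats: `…BystanderBHK.lean` (k42),
`…SandwichCoreS.lean` (k41), `…GnegBase.lean` (k17), `…PocketBHKPrelim.lean` (k9); this file reuses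
only `BystanderBHK.ind_congr`.)
-/

noncomputable section

open Literature.Probability.Percolation Literature.Probability.Percolation.BHK2006 DecisionTree

namespace Summit.CriticalPhenomena.PercolationContinuityZ3.Theorems.SandwichBHK

open scoped Classical

/-! Local notations (no new definitions): `ℙ[w] A` the weight-sum probability of the event `A`;
`rF[U, a, b]` the connection event `{a ↔ b}` of `G[U]`; `rV[U, S, ω]` the finite set of vertices of
`G[U]` reachable from the source set `S`; `rE[U, o, R, X]` the **sandwich event**
`{o ↔ X} ∪ ({o ↮ X} ∩ {C(o) ∈ R})` for a family `R` of vertex sets; `rB[U, Y]` the moat event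
(no open edge between `Y` and `U ∖ Y`, i.e. BHK's random set of `Y` is empty). -/
local notation3 "ℙ[" w "] " A:max => ∑ ω, weight w ω * ind A ω
local notation3 "rF[" U ", " a ", " b "]" =>
  {ω : Set (Sym2 _) | (openGraph (ω ∩ edgesIn U)).Reachable a b}
local notation3 "rV[" U ", " S ", " ω "]" =>
  Finset.univ.filter (fun v => ∃ s ∈ (S : Set _), (openGraph (ω ∩ edgesIn U)).Reachable s v)
local notation3 "rE[" U ", " o ", " R ", " X "]" =>
  {ω : Set (Sym2 _) | (∃ x ∈ (X : Set _), (openGraph (ω ∩ edgesIn U)).Reachable o x) ∨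
    (ω ∈ rD U o X ∧ ∃ W ∈ (R : Set (Finset _)), ∀ v, v ∈ W ↔ (openGraph (ω ∩ edgesIn U)).Reachable o v)}
local notation3 "rB[" U ", " Y "]" => {ω : Set (Sym2 _) | ∀ n, n ∉ rS U Y ω}

section Core

variable {V : Type*} [Fintype V] {w : Sym2 V → ℝ}

/-! #### Base case of the sandwich induction -/

/-- **Base inequality** (no hypothesis on `S ∩ T`):
`P(a↔b, E_S, a↮S) · P(a↮T) ≤ P(a↔b) · P(E_{S∪T}, a↮(S∪T))`.
Decompose `E_S ∩ {a ↮ S}` along the value `Y ∋ o` of the set reachable from `S` and the values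
`W ∈ R` of the cluster of `o`; each piece is a moat event, and the moat lemma applies. [new] -/
theorem base (hw0 : ∀ e, 0 ≤ w e) (hw1 : ∀ e, w e ≤ 1) (hm : ∑ ω, weight w ω = 1)
    {U : Finset V} {o a b : V} (hoU : o ∈ U) (R : Set (Finset V)) (hR : ∀ W ∈ R, a ∉ W)
    {S : Set V} (hSU : S ⊆ ↑U) (T : Set V) :
    ℙ[w] (rF[U, a, b] ∩ rE[U, o, R, S] ∩ rD U a S) * ℙ[w] (rD U a T) ≤
      ℙ[w] (rF[U, a, b]) * ℙ[w] (rE[U, o, R, (S ∪ T)] ∩ rD U a (S ∪ T)) := by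
  set cα : Finset V → ℝ := fun Y => if o ∈ Y ∧ a ∉ Y then 1 else 0 with hcα
  set Jα : Finset V → Set (Set (Sym2 V)) := fun Y => {ω | rV[U, S, ω] = Y} with hJα
  set cβ : Finset V → ℝ := fun W => if W ∈ R then 1 else 0 with hcβ
  set Jβ : Finset V → Set (Set (Sym2 V)) := fun W => {ω | rV[U, {o}, ω] = W ∧ ω ∈ rD U o S}
    with hJβ
  -- two elementary facts
  have hOS : ∀ ω, o ∈ rV[U, S, ω] ↔ ∃ x ∈ S, (openGraph (ω ∩ edgesIn U)).Reachable o x := fun ω => by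
    rw [mem_rV]
    exact ⟨fun ⟨s, hs, h⟩ => ⟨s, hs, h.symm⟩, fun ⟨s, hs, h⟩ => ⟨s, hs, h.symm⟩⟩
  have haS : ∀ ω, ω ∈ rD U a S → a ∉ rV[U, S, ω] := fun ω hD haV => by
    obtain ⟨s, hs, h⟩ := mem_rV.1 haV
    exact hD s hs h.symm
  have hOD : ∀ ω, (∃ x ∈ S, (openGraph (ω ∩ edgesIn U)).Reachable o x) → ω ∉ rD U o S :=
    fun ω ⟨x, hx, h⟩ hD => hD x hx h
  -- collapsing the sums at a point
  have sumα : ∀ (P : Set (Set (Sym2 V))) (ω : Set (Sym2 V)),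
      ∑ Y, cα Y * ind (Jα Y ∩ P) ω = cα (rV[U, S, ω]) * ind P ω := by
    intro P ω
    rw [Finset.sum_eq_single (rV[U, S, ω])]
    · congr 1
      exact BystanderBHK.ind_congr ⟨fun h => h.2, fun h => ⟨rfl, h⟩⟩
    · intro Y _ hY
      rw [ind_of_not_mem (fun h => hY h.1.symm), mul_zero]
    · intro h; exact absurd (Finset.mem_univ _) h
  have sumβ : ∀ (P : Set (Set (Sym2 V))) (ω : Set (Sym2 V)),
      ∑ W, cβ W * ind (Jβ W ∩ P) ω = cβ (rV[U, {o}, ω]) * ind (rD U o S ∩ P) ω := by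
    intro P ω
    rw [Finset.sum_eq_single (rV[U, {o}, ω])]
    · congr 1
      exact BystanderBHK.ind_congr ⟨fun h => ⟨h.1.2, h.2⟩, fun h => ⟨⟨rfl, h.1⟩, h.2⟩⟩
    · intro W _ hW
      rw [ind_of_not_mem (fun h => hW h.1.1.symm), mul_zero]
    · intro h; exact absurd (Finset.mem_univ _) h
  -- (pt1) pointwise decomposition of the left event
  have pt1 : ∀ ω, ind (rF[U, a, b] ∩ rE[U, o, R, S] ∩ rD U a S) ω =
      ∑ Y, cα Y * ind (Jα Y ∩ (rF[U, a, b] ∩ rD U a S)) ω +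
        ∑ W, cβ W * ind (Jβ W ∩ (rF[U, a, b] ∩ rD U a S)) ω := by
    intro ω
    rw [sumα, sumβ]
    by_cases hFD : ω ∈ rF[U, a, b] ∩ rD U a S
    · have h1 : ind (rF[U, a, b] ∩ rD U a S) ω = 1 := ind_of_mem hFD
      rw [h1, mul_one]
      by_cases hO : ∃ x ∈ S, (openGraph (ω ∩ edgesIn U)).Reachable o x
      · have hl : ω ∈ rF[U, a, b] ∩ rE[U, o, R, S] ∩ rD U a S := ⟨⟨hFD.1, Or.inl hO⟩, hFD.2⟩
        rw [ind_of_mem hl, ind_of_not_mem (X := rD U o S ∩ (rF[U, a, b] ∩ rD U a S))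
          (fun h => hOD ω hO h.1), mul_zero, add_zero, hcα]
        simp only
        rw [if_pos ⟨(hOS ω).2 hO, haS ω hFD.2⟩]
      · have hα0 : cα (rV[U, S, ω]) = 0 := by
          rw [hcα]; simp only; rw [if_neg (fun h => hO ((hOS ω).1 h.1))]
        rw [hα0, zero_add]
        have hDo : ω ∈ rD U o S := fun x hx h => hO ⟨x, hx, h⟩
        have h2 : ind (rD U o S ∩ (rF[U, a, b] ∩ rD U a S)) ω = 1 := ind_of_mem ⟨hDo, hFD⟩
        rw [h2, mul_one]
        by_cases hKR : rV[U, {o}, ω] ∈ R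
        · have hmem : ω ∈ rF[U, a, b] ∩ rE[U, o, R, S] ∩ rD U a S :=
            ⟨⟨hFD.1, Or.inr ⟨hDo, exists_iff_rV_mem.2 hKR⟩⟩, hFD.2⟩
          rw [ind_of_mem hmem, hcβ]
          simp only; rw [if_pos hKR]
        · rw [ind_of_not_mem, hcβ]
          · simp only; rw [if_neg hKR]
          · rintro ⟨⟨-, hO' | ⟨-, hKR'⟩⟩, -⟩
            · exact hO hO'
            · exact hKR (exists_iff_rV_mem.1 hKR')
    · have h1 : ind (rF[U, a, b] ∩ rD U a S) ω = 0 := ind_of_not_mem hFD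
      have h2 : ind (rD U o S ∩ (rF[U, a, b] ∩ rD U a S)) ω = 0 := ind_of_not_mem (fun h => hFD h.2)
      rw [h1, h2, mul_zero, mul_zero, add_zero]
      exact ind_of_not_mem (fun h => hFD ⟨h.1.1, h.2⟩)
  -- (pt2) the pieces with `a ↮ T` are disjoint sub-events of `E_{S∪T} ∩ {a ↮ S ∪ T}`
  have pt2 : ∀ ω, ∑ Y, cα Y * ind (Jα Y ∩ (rD U a S ∩ rD U a T)) ω +
        ∑ W, cβ W * ind (Jβ W ∩ (rD U a S ∩ rD U a T)) ω ≤
      ind (rE[U, o, R, (S ∪ T)] ∩ rD U a (S ∪ T)) ω := by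
    intro ω
    rw [sumα, sumβ]
    have hcα1 : cα (rV[U, S, ω]) ≤ 1 := by rw [hcα]; simp only; split_ifs <;> norm_num
    have hcα0 : 0 ≤ cα (rV[U, S, ω]) := by rw [hcα]; simp only; split_ifs <;> norm_num
    have hcβ1 : cβ (rV[U, {o}, ω]) ≤ 1 := by rw [hcβ]; simp only; split_ifs <;> norm_num
    have hcβ0 : 0 ≤ cβ (rV[U, {o}, ω]) := by rw [hcβ]; simp only; split_ifs <;> norm_num
    by_cases hST : ω ∈ rD U a S ∩ rD U a T
    · have hDu : ω ∈ rD U a (S ∪ T) := by rw [rD_union]; exact hST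
      by_cases hO : ∃ x ∈ S, (openGraph (ω ∩ edgesIn U)).Reachable o x
      · have hr : ω ∈ rE[U, o, R, (S ∪ T)] ∩ rD U a (S ∪ T) := by
          obtain ⟨x, hx, h⟩ := hO
          exact ⟨Or.inl ⟨x, Or.inl hx, h⟩, hDu⟩
        rw [ind_of_mem hr, ind_of_not_mem (X := rD U o S ∩ (rD U a S ∩ rD U a T))
          (fun h => hOD ω hO h.1), mul_zero, add_zero]
        calc cα (rV[U, S, ω]) * ind (rD U a S ∩ rD U a T) ω ≤ 1 * 1 :=
              mul_le_mul hcα1 (ind_le_one _ _) (ind_nonneg _ _) zero_le_one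
          _ = 1 := one_mul 1
      · have hα0 : cα (rV[U, S, ω]) = 0 := by
          rw [hcα]; simp only; rw [if_neg (fun h => hO ((hOS ω).1 h.1))]
        rw [hα0, zero_mul, zero_add]
        by_cases hKR : rV[U, {o}, ω] ∈ R
        · have hr : ω ∈ rE[U, o, R, (S ∪ T)] ∩ rD U a (S ∪ T) := by
            refine ⟨?_, hDu⟩
            by_cases hOT : ∃ x ∈ T, (openGraph (ω ∩ edgesIn U)).Reachable o x
            · obtain ⟨x, hx, h⟩ := hOT
              exact Or.inl ⟨x, Or.inr hx, h⟩
            · refine Or.inr ⟨?_, exists_iff_rV_mem.2 hKR⟩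
              rintro x (hx | hx) h
              · exact hO ⟨x, hx, h⟩
              · exact hOT ⟨x, hx, h⟩
          rw [ind_of_mem hr]
          calc cβ (rV[U, {o}, ω]) * ind (rD U o S ∩ (rD U a S ∩ rD U a T)) ω ≤ 1 * 1 :=
                mul_le_mul hcβ1 (ind_le_one _ _) (ind_nonneg _ _) zero_le_one
            _ = 1 := one_mul 1
        · have hβ0 : cβ (rV[U, {o}, ω]) = 0 := by rw [hcβ]; simp only; rw [if_neg hKR]
          rw [hβ0, zero_mul]
          exact ind_nonneg _ _
    · rw [ind_of_not_mem hST, ind_of_not_mem (fun h => hST h.2), mul_zero, mul_zero, add_zero]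
      exact ind_nonneg _ _
  -- the moat lemma on each piece
  have hα : ∀ Y, cα Y * (ℙ[w] (Jα Y ∩ (rF[U, a, b] ∩ rD U a S)) * ℙ[w] (rD U a T)) ≤
      cα Y * (ℙ[w] (rF[U, a, b]) * ℙ[w] (Jα Y ∩ (rD U a S ∩ rD U a T))) := by
    intro Y
    by_cases hY : o ∈ Y ∧ a ∉ Y
    · have h1 : cα Y = 1 := by rw [hcα]; simp only; rw [if_pos hY]
      rw [h1, one_mul, one_mul, ← Set.inter_assoc, ← Set.inter_assoc]
      refine moat hw0 hw1 hm hY.2 (fun ω => ?_) (fun ω hω => rB_of_rV_eq hSU hω) S T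
      exact (rV_inter_meeting_eq_iff U Y S ω).symm
    · have h0 : cα Y = 0 := by rw [hcα]; simp only; rw [if_neg hY]
      rw [h0, zero_mul, zero_mul]
  have hoU' : ({o} : Set V) ⊆ ↑U := Set.singleton_subset_iff.2 (Finset.mem_coe.2 hoU)
  have hβ : ∀ W, cβ W * (ℙ[w] (Jβ W ∩ (rF[U, a, b] ∩ rD U a S)) * ℙ[w] (rD U a T)) ≤
      cβ W * (ℙ[w] (rF[U, a, b]) * ℙ[w] (Jβ W ∩ (rD U a S ∩ rD U a T))) := by
    intro W
    by_cases hW : W ∈ R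
    · have h1 : cβ W = 1 := by rw [hcβ]; simp only; rw [if_pos hW]
      rw [h1, one_mul, one_mul, ← Set.inter_assoc, ← Set.inter_assoc]
      refine moat hw0 hw1 hm (hR W hW) (fun ω => ?_) (fun ω hω => rB_of_rV_eq hoU' hω.1) S T
      constructor
      · rintro ⟨hK, hD⟩
        exact ⟨(rV_inter_meeting_eq_iff U W {o} ω).2 hK, rD_decreasing Set.inter_subset_left hD⟩
      · rintro ⟨hK', hD'⟩
        have hK : rV[U, {o}, ω] = W := (rV_inter_meeting_eq_iff U W {o} ω).1 hK'
        refine ⟨hK, fun x hx h => hD' x hx ?_⟩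
        have hx' : x ∈ rV[U, {o}, (ω ∩ meeting W)] := by
          rw [hK', ← hK]; exact mem_rV_singleton.2 h
        exact mem_rV_singleton.1 hx'
    · have h0 : cβ W = 0 := by rw [hcβ]; simp only; rw [if_neg hW]
      rw [h0, zero_mul, zero_mul]
  -- assembly
  have L1 : ℙ[w] (rF[U, a, b] ∩ rE[U, o, R, S] ∩ rD U a S) =
      ∑ Y, cα Y * ℙ[w] (Jα Y ∩ (rF[U, a, b] ∩ rD U a S)) +
        ∑ W, cβ W * ℙ[w] (Jβ W ∩ (rF[U, a, b] ∩ rD U a S)) := by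
    rw [← sum_weight_sum, ← sum_weight_sum, ← Finset.sum_add_distrib]
    refine Finset.sum_congr rfl fun ω _ => ?_
    rw [pt1 ω, mul_add]
  have L2 : ∑ Y, cα Y * ℙ[w] (Jα Y ∩ (rD U a S ∩ rD U a T)) +
        ∑ W, cβ W * ℙ[w] (Jβ W ∩ (rD U a S ∩ rD U a T)) ≤
      ℙ[w] (rE[U, o, R, (S ∪ T)] ∩ rD U a (S ∪ T)) := by
    rw [← sum_weight_sum, ← sum_weight_sum, ← Finset.sum_add_distrib]
    refine Finset.sum_le_sum fun ω _ => ?_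
    rw [← mul_add]
    exact mul_le_mul_of_nonneg_left (pt2 ω) (weight_nonneg hw0 hw1 ω)
  have nF := pr_nonneg hw0 hw1 (w := w) (rF[U, a, b])
  calc ℙ[w] (rF[U, a, b] ∩ rE[U, o, R, S] ∩ rD U a S) * ℙ[w] (rD U a T)
      = ∑ Y, cα Y * (ℙ[w] (Jα Y ∩ (rF[U, a, b] ∩ rD U a S)) * ℙ[w] (rD U a T)) +
          ∑ W, cβ W * (ℙ[w] (Jβ W ∩ (rF[U, a, b] ∩ rD U a S)) * ℙ[w] (rD U a T)) := by
        rw [L1, add_mul, Finset.sum_mul, Finset.sum_mul]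
        simp_rw [mul_assoc]
    _ ≤ ∑ Y, cα Y * (ℙ[w] (rF[U, a, b]) * ℙ[w] (Jα Y ∩ (rD U a S ∩ rD U a T))) +
          ∑ W, cβ W * (ℙ[w] (rF[U, a, b]) * ℙ[w] (Jβ W ∩ (rD U a S ∩ rD U a T))) :=
        add_le_add (Finset.sum_le_sum fun Y _ => hα Y) (Finset.sum_le_sum fun W _ => hβ W)
    _ = ℙ[w] (rF[U, a, b]) * (∑ Y, cα Y * ℙ[w] (Jα Y ∩ (rD U a S ∩ rD U a T)) +
          ∑ W, cβ W * ℙ[w] (Jβ W ∩ (rD U a S ∩ rD U a T))) := by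
        rw [mul_add, Finset.mul_sum, Finset.mul_sum]
        congr 1 <;> exact Finset.sum_congr rfl fun _ _ => by ring
    _ ≤ ℙ[w] (rF[U, a, b]) * ℙ[w] (rE[U, o, R, (S ∪ T)] ∩ rD U a (S ∪ T)) :=
        mul_le_mul_of_nonneg_left L2 nF

end Core

end Summit.CriticalPhenomena.PercolationContinuityZ3.Theorems.SandwichBHK

namespace Summit.CriticalPhenomena.PercolationContinuityZ3.Theorems

open Literature.Probability.LatticeModels Literature.Probability.Percolation
open scoped Classical

/-- **Registered stub `stub_sandwichBase_k18`** (siege k18, file 2/5): the base inequality `SandwichBHK.base` on `Fin n`, verbatim registered signature. [new] -/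
theorem stub_sandwichBase_k18 :
    ∀ (n : ℕ) (w : Sym2 (Fin n) → ℝ), (∀ e, 0 ≤ w e) → (∀ e, w e ≤ 1) → ∑ ω, Literature.Probability.Percolation.BHK2006.weight w ω = 1 → ∀ (U : Finset (Fin n)) (o a b : Fin n), o ∈ U → ∀ (R : Set (Finset (Fin n))), (∀ W ∈ R, a ∉ W) → ∀ (S T : Set (Fin n)), S ⊆ ↑U → (∑ ω, Literature.Probability.Percolation.BHK2006.weight w ω * Literature.Probability.Percolation.DecisionTree.ind ({ω : Set (Sym2 (Fin n)) | (openGraph (ω ∩ Literature.Probability.Percolation.BHK2006.edgesIn U)).Reachable a b} ∩ {ω : Set (Sym2 (Fin n)) | (∃ x ∈ S, (openGraph (ω ∩ Literature.Probability.Percolation.BHK2006.edgesIn U)).Reachable o x) ∨ (ω ∈ Literature.Probability.Percolation.BHK2006.rD U o S ∧ ∃ W ∈ R, ∀ v, v ∈ W ↔ (openGraph (ω ∩ Literature.Probability.Percolation.BHK2006.edgesIn U)).Reachable o v)} ∩ Literature.Probability.Percolation.BHK2006.rD U a S) ω) * (∑ ω, Literature.Probability.Percolation.BHK2006.weight w ω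 * Literature.Probability.Percolation.DecisionTree.ind (Literature.Probability.Percolation.BHK2006.rD U a T) ω) ≤ (∑ ω, Literature.Probability.Percolation.BHK2006.weight w ω * Literature.Probability.Percolation.DecisionTree.ind {ω : Set (Sym2 (Fin n)) | (openGraph (ω ∩ Literature.Probability.Percolation.BHK2006.edgesIn U)).Reachable a b} ω) * (∑ ω, Literature.Probability.Percolation.BHK2006.weight w ω * Literature.Probability.Percolation.DecisionTree.ind ({ω : Set (Sym2 (Fin n)) | (∃ x ∈ (S ∪ T), (openGraph (ω ∩ Literature.Probability.Percolation.BHK2006.edgesIn U)).Reachable o x) ∨ (ω ∈ Literature.Probability.Percolation.BHK2006.rD U o (S ∪ T) ∧ ∃ W ∈ R, ∀ v, v ∈ W ↔ (openGraph (ω ∩ Literature.Probability.Percolation.BHK2006.edgesIn U)).Reachable o v)} ∩ Literature.Probability.Percolation.BHK2006.rD U a (S ∪ T)) ω) :=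
  fun _ _ hw0 hw1 hm _ _ _ _ hoU R hR _ T hSU => SandwichBHK.base hw0 hw1 hm hoU R hR hSU T

end Summit.CriticalPhenomena.PercolationContinuityZ3.Theorems
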